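import Summits.Langlands.Langlands.Theorems.TwinRigiditySplitPrelude
import Literature.NumberTheory.GaloisRepresentations.TateTwistFrobeniusProofs
import Literature.RepresentationTheory.Semisimple.Twist
import Literature.NumberTheory.Automorphic.WeaklyRegularGaloisRepNormTwistProofs

/-!
CENSUS LANDING NOTE (decomp-langlands census-1 g29): lens-4 g29 certified landing split `landing/TwinRigiditySplitRegular.lean` with ONE
delta — the primed local copy `arithFrobPolyOfSatake_eq_prod_map'` is deleted and the identical landed declaration
`Literature.NumberTheory.Automorphic.arithFrobPolyOfSatake_eq_prod_map` is imported and reused (gate `dedup.landed`).  Nothing else changed.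

# `TwinRigiditySplitRegular` — the regular-algebraic odd-rank cell of ALR (part 3 of 3 of the lens-4 g29 node `TwinRigiditySplit`)

`alr_regularAlgebraic_odd (hH : exists_galoisRep_of_regularAlgebraic) (hn : Odd n) : AutomorphicLayerRigidityRegularAt n` — automorphic layer
rigidity for REGULAR algebraic `π, π'` of ODD rank over a totally real or CM field, along any Galois layer without cyclic-prime sub-layers,
conditional BY NAME on the single HLTT/Scholze–Varma named fact: both members get semisimple L-normalised `ℓ`-adic avatars
(`exists_avatar_of_regularAlgebraic`: the fact's C-normalised representation Tate-twisted by the integral power `ε_ℓ^{(n-1)/2}`), and the Prelude's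
`alr_pointwise_of_avatars` decides the pair.  0 sorry; imports = the Prelude + `TateTwistFrobeniusProofs` + `RepresentationTheory.Semisimple.Twist`.
-/

set_option linter.dupNamespace false
set_option linter.unusedVariables false
set_option linter.style.longLine false

namespace Summit.Langlands.Langlands.Theorems.TwinRigiditySplit

open scoped BigOperators Topology Matrix Classical
open Filter Set Function
open Literature.NumberTheory.GaloisRepresentations Literature.NumberTheory.Automorphic
open IsDedekindDomain
open Summit.Langlands.Langlands.Theses
open Summit.Langlands.Langlands.Theses.GaloisHullLift
open Summit.Langlands.Langlands.Theorems.TatePhantomLift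
open scoped NumberField Polynomial

/-! ## §3b Regular-algebraic odd-rank cell (HLTT / Scholze / Varma BY NAME)

The second PROVED cell of ALR after `alr_rankOne`: for ODD `n`, `K` totally real or CM and `π, π'` REGULAR algebraic, both members of a would-be twin
pair have semisimple `ℓ`-adic avatars in the L-normalisation — the named Literature fact `exists_galoisRep_of_regularAlgebraic` (HLTT 2016 Thm A /
Scholze 2015 / Varma; C-normalisation `arithFrobPolyOfSatake ι q_v n α`, i.e. predicted roots `ι⁻¹((q_v^{(n-1)/2} a)⁻¹)`) Tate-twisted by the INTEGRAL
power `ε_ℓ^{(n-1)/2}` (tree `FramedRep.twist`, `exists_cyclotomicCharacter_padicAlgCl_zpow`, `isUnramifiedAt_twist`, `hasFrobCharpolyAt_twist_of_eq_prod`;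
semisimplicity through `Representation.isSemisimpleRepresentation_twist_iff`) — and `alr_pointwise_of_avatars` applies.  For EVEN `n` the half-twist
`ε_ℓ^{(n-1)/2}` is not a character of `Γ_K` (Buzzard–Gee: L-algebraic ≠ C-algebraic in even rank), so this cell is honestly restricted to odd rank; the
regular-algebraic even-rank slice would need the C-group form of the avatar and is NOT attempted here. -/

section RegularAlgebraic

open Polynomial NumberField Literature.RepresentationTheory.Semisimple

variable {K : Type} [Field K] [NumberField K] {ℓ : ℕ} [Fact ℓ.Prime] {n : ℕ}

/-- The places above `ℓ` are finitely many (Mathlib `Ideal.finite_factors`; private copy of the kernel file's lemma, to keep this file's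
imports at the Prelude). [folklore] -/
private theorem eventually_natCast_notMem_asIdeal (K : Type) [Field K] [NumberField K] (ℓ : ℕ)
    [Fact ℓ.Prime] : ∀ᶠ v : HeightOneSpectrum (𝓞 K) in cofinite, ((ℓ : ℕ) : 𝓞 K) ∉ v.asIdeal := by
  have hne : Ideal.span {((ℓ : ℕ) : 𝓞 K)} ≠ ⊥ := by
    rw [Ne, Ideal.span_singleton_eq_bot]
    exact_mod_cast (Fact.out : ℓ.Prime).ne_zero
  refine Filter.mem_of_superset (Ideal.finite_factors hne).compl_mem_cofinite ?_
  intro v hv hmem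
  exact hv (Ideal.dvd_span_singleton.2 hmem)


/-- ALR(n) restricted to `K` totally real or CM and `π, π'` regular algebraic (three hypotheses inserted into `AutomorphicLayerRigidityAt n`, nothing
else changed; `alrRegularAt_of_alrAt` is the literal-slice check). -/
def AutomorphicLayerRigidityRegularAt (n : ℕ) : Prop :=
  ∀ (K : Type) [Field K] [NumberField K] (hcpt : Literature.NumberTheory.Automorphic.isCompact_glFiniteIntegralLevel n K), 0 < n → (IsTotallyReal K ∨ NumberField.IsCMField K) → ∀ (π : Literature.NumberTheory.Automorphic.CuspidalAutomorphicRepData n K hcpt), π.1.IsLAlgebraic → π.1.IsRegularAlgebraic → ∀ (π' : Literature.NumberTheory.Automorphic.CuspidalAutomorphicRepData n K hcpt), π'.1.IsLAlgebraic → π'.1.IsRegularAlgebraic → ∀ (L : Type) [Field L] [NumberField L] [Algebra K L], IsGalois K L → Module.finrank K L ≠ 1 → (¬ ∃ F : IntermediateField K L, F ≠ ⊥ ∧ IsGalois K ↥F ∧ IsCyclic (↥F ≃ₐ[K] ↥F) ∧ (Module.finrank K ↥F).Prime) → ∀ (ℓ : ℕ) [Fact ℓ.Prime] (ι : PadicAlgCl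 ℓ ≃+* ℂ) (r : Literature.NumberTheory.GaloisRepresentations.FramedGaloisRep L (PadicAlgCl ℓ) n), r.toGaloisRep.IsSemisimple → r.IsIrreducible → (∀ᶠ w : IsDedekindDomain.HeightOneSpectrum (NumberField.RingOfIntegers L) in cofinite, ∀ (v : IsDedekindDomain.HeightOneSpectrum (NumberField.RingOfIntegers K)) (α : Multiset ℂ), w.asIdeal.under (NumberField.RingOfIntegers K) = v.asIdeal → π.1.HasSatakeParamAt v α → r.IsUnramifiedAt w ∧ r.HasFrobCharpolyAt w (Literature.NumberTheory.Automorphic.arithFrobPolyOfSatake ι w.residueCard 1 (α.map (fun a => a ^ w.asIdeal.inertiaDeg (NumberField.RingOfIntegers K))))) → (∀ᶠ w : IsDedekindDomain.HeightOneSpectrum (NumberField.RingOfIntegers L) in cofinite, ∀ (v : IsDedekindDomain.HeightOneSpectrum (NumberField.RingOfIntegers K)) (α : Multiset ℂ), w.asIdeal.under (NumberField.RingOfIntegers K) = v.asIdeal → π'.1.HasSatakeParamAt v α → r.IsUnramifiedAt w ∧ r.HasFrobCharpolyAt w (Literature.NumberTheory.Automorphic.arithFrobPolyOfSatake ι w.residueCard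 1 (α.map (fun a => a ^ w.asIdeal.inertiaDeg (NumberField.RingOfIntegers K))))) → ∀ᶠ v : IsDedekindDomain.HeightOneSpectrum (NumberField.RingOfIntegers K) in cofinite, ∀ (α β : Multiset ℂ), π.1.HasSatakeParamAt v α → π'.1.HasSatakeParamAt v β → α = β

/-- The regular slice IS a slice of ALR(n). -/
theorem alrRegularAt_of_alrAt (h : AutomorphicLayerRigidityAt n) : AutomorphicLayerRigidityRegularAt n := by
  intro K _ _ hcpt hn _ π hπ _ π' hπ' _ L _ _ _ hGal h1 hnc ℓ _ ι r hr hirr hrel hrel'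
  exact h K hcpt hn π hπ π' hπ' L hGal h1 hnc ℓ ι r hr hirr hrel hrel'

omit [NumberField K] in
/-- Twisting a framed Galois representation by a character preserves semisimplicity (tree `Representation.isSemisimpleRepresentation_twist_iff`,
transported along the unfolding of `FramedRep.twist`). [folklore] -/
theorem isSemisimple_twist (r : FramedGaloisRep K (PadicAlgCl ℓ) n) (hr : r.toGaloisRep.IsSemisimple)
    (χ : Field.absoluteGaloisGroup K →ₜ* (PadicAlgCl ℓ)ˣ) :
    (FramedGaloisRep.toGaloisRep (K := K) (FramedRep.twist r χ)).IsSemisimple := by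
  have e : (FramedGaloisRep.toGaloisRep (K := K) (FramedRep.twist r χ)).toRepresentation =
      Representation.twist r.toGaloisRep.toRepresentation χ.toMonoidHom := by
    refine MonoidHom.ext fun g => LinearMap.ext fun v => ?_
    change (FramedRep.twist r χ).toRepresentation g v = ((χ g : (PadicAlgCl ℓ)ˣ) : PadicAlgCl ℓ) • r.toRepresentation g v
    rw [FramedRep.toRepresentation_apply_apply, FramedRep.toRepresentation_apply_apply, FramedRep.coe_twist_apply,
      Matrix.smul_mulVec]
  haveI : r.toGaloisRep.toRepresentation.IsSemisimpleRepresentation := hr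
  change (FramedGaloisRep.toGaloisRep (K := K) (FramedRep.twist r χ)).toRepresentation.IsSemisimpleRepresentation
  rw [e]
  exact (Representation.isSemisimpleRepresentation_twist_iff _ _).mpr ‹_›

/-- The half-integral Tate twist is integral in odd rank: `ι⁻¹((√q)^{2k}) = q^k`. [folklore] -/
theorem symm_sqrt_pow_two_mul (ι : PadicAlgCl ℓ ≃+* ℂ) (q k : ℕ) :
    ι.symm (((Real.sqrt q : ℝ) : ℂ) ^ (2 * k)) = (q : PadicAlgCl ℓ) ^ k := by
  have h : ((Real.sqrt q : ℝ) : ℂ) ^ (2 * k) = (q : ℂ) ^ k := by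
    rw [pow_mul, ← Complex.ofReal_pow, Real.sq_sqrt (Nat.cast_nonneg q), Complex.ofReal_natCast]
  rw [h, map_pow, map_natCast]

-- `arithFrobPolyOfSatake_eq_prod_map` is REUSED from `Literature.NumberTheory.Automorphic.WeaklyRegularGaloisRepNormTwistProofs`
-- (gate dedup.landed at the census landing; the node's primed local copy is deleted).

/-- **Avatars in the L-normalisation for regular algebraic `π` of odd rank over a totally real or CM field** (0 sorry), from the named fact
`exists_galoisRep_of_regularAlgebraic` by the Tate twist `ε_ℓ^{(n-1)/2}`: the twist is semisimple (`isSemisimple_twist`), unramified wherever `r` is at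
`v ∤ ℓ` (`isUnramifiedAt_twist`, `eq_one_of_mem_inertia_of_cyclotomic_zpow`), and its Frobenius roots are the C-normalised ones multiplied by `q_v^k`
(`hasFrobCharpolyAt_twist_of_eq_prod`, `coe_apply_of_isArithFrobAt_of_cyclotomic_zpow`), i.e. `q_v^k · ι⁻¹((q_v^k a)⁻¹) = ι⁻¹(a⁻¹)` = the parameter-`1`
prediction of `SatakeFrobCompatibleAt`. [HarrisLanTaylorThorne2016 Thm A; Varma 2024; folklore bookkeeping] -/
theorem exists_avatar_of_regularAlgebraic (hH : exists_galoisRep_of_regularAlgebraic)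
    (hcpt : isCompact_glFiniteIntegralLevel n K) (hK : IsTotallyReal K ∨ IsCMField K) (k : ℕ) (hn : n = 2 * k + 1)
    (π : CuspidalAutomorphicRepData n K hcpt) (hreg : π.1.IsRegularAlgebraic) (ι : PadicAlgCl ℓ ≃+* ℂ) :
    ∃ ρ : FramedGaloisRep K (PadicAlgCl ℓ) n, ρ.toGaloisRep.IsSemisimple ∧
      ∀ᶠ v : HeightOneSpectrum (𝓞 K) in cofinite, SatakeFrobCompatibleAt ι π.1 ρ v := by
  obtain ⟨r, hrss, hr⟩ := hH hcpt hK π hreg ℓ ι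
  obtain ⟨ε, hε⟩ := exists_cyclotomicCharacter_padicAlgCl_zpow K ℓ (k : ℤ)
  refine ⟨FramedRep.twist r ε, isSemisimple_twist r hrss ε, ?_⟩
  filter_upwards [eventually_natCast_notMem_asIdeal K ℓ, π.1.hasSatakeParamAt_cofinite_holds] with v hvℓ hv
  obtain ⟨α, hα⟩ := hv
  obtain ⟨hur, hch⟩ := hr v α hα hvℓ
  refine ⟨α, hα, FramedGaloisRep.isUnramifiedAt_twist hur (fun 𝔓 h𝔓 σ hσ => eq_one_of_mem_inertia_of_cyclotomic_zpow hε hvℓ h𝔓 hσ), ?_⟩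
  set q := v.residueCard with hq
  have hq0 : (q : PadicAlgCl ℓ) ≠ 0 := Nat.cast_ne_zero.mpr (zero_lt_one.trans v.one_lt_residueCard).ne'
  rw [Literature.NumberTheory.Automorphic.arithFrobPolyOfSatake_eq_prod_map] at hch
  have h2 := FramedGaloisRep.hasFrobCharpolyAt_twist_of_eq_prod (χ := ε) (c := (q : PadicAlgCl ℓ) ^ (k : ℤ)) hch
    (fun 𝔓 h𝔓 σ hσ => coe_apply_of_isArithFrobAt_of_cyclotomic_zpow hε hvℓ h𝔓 hσ)
  have e : (((α.map fun a => ι.symm ((((Real.sqrt q : ℝ) : ℂ) ^ (n - 1) * a)⁻¹)).map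
      fun b => X - C ((q : PadicAlgCl ℓ) ^ (k : ℤ) * b)).prod) = arithFrobPolyOfSatake ι q 1 α := by
    rw [arithFrobPolyOfSatake_one, Multiset.map_map]
    congr 1
    refine Multiset.map_congr rfl fun a _ => ?_
    simp only [Function.comp_apply]
    congr 2
    have hn1 : n - 1 = 2 * k := by omega
    rw [hn1, mul_inv, map_mul, map_inv₀, symm_sqrt_pow_two_mul, zpow_natCast, ← mul_assoc,
      mul_inv_cancel₀ (pow_ne_zero _ hq0), one_mul]
  rw [e] at h2
  exact h2

/-- **ALR for regular algebraic `π, π'` of ODD rank over a totally real or CM field (PROVED CELL, conditional BY NAME on the single named fact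
`exists_galoisRep_of_regularAlgebraic`).**  Both members have semisimple avatars (`exists_avatar_of_regularAlgebraic`), so `alr_pointwise_of_avatars`
— the Galois shadow §1 + strong multiplicity one packaged as `satake_eq_of_compatible_conj` — decides the pair.  Consequently a twin pair (the type-(b)
minimal counterexample to RIGID) in odd rank over a CM/totally real field has at least one IRREGULAR (or non-regular-algebraic) member. -/
theorem alr_regularAlgebraic_odd (hH : exists_galoisRep_of_regularAlgebraic) (hn : Odd n) : AutomorphicLayerRigidityRegularAt n := by
  intro K _ _ hcpt _ hK π _ hπr π' _ hπr' L _ _ _ hGal h1 hnc ℓ _ ι r hr hirr hrel hrel'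
  haveI := hGal
  obtain ⟨k, hk⟩ := hn
  obtain ⟨ρ, hρ, hc⟩ := exists_avatar_of_regularAlgebraic hH hcpt hK k hk π hπr ι
  obtain ⟨ρ', hρ', hc'⟩ := exists_avatar_of_regularAlgebraic hH hcpt hK k hk π' hπr' ι
  exact alr_pointwise_of_avatars hnc π.1 π'.1 ι r hr hirr hrel hrel' ρ hρ hc ρ' hρ' hc'

end RegularAlgebraic

end Summit.Langlands.Langlands.Theorems.TwinRigiditySplit
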